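import Mathlib
import HarnessLib
import Summits.ValiantsHypothesis.ValiantsHypothesis.Theorems.LacunarySymmetroidMatrixDescartesOsculationLawCuspCubicSupport

/-!
# ValiantsHypothesis / LacunarySymmetroid — crux `MatrixDescartes` (stmt-ValiantsHypothesis-18050, V1),
# line «osculation-law»: the NON-MONIC cubic cusp curve — supports of `L₁, L₀, N, N′` and the numeric bound

Support bookkeeping for the count half (β) of the rank-three column `(3, s)`: at that splitting the letter data have
`supp aₖ ⊆ (s + 3 − k) • E` (`aₖ` = sum of the principal cofactors of co-size `k`, val-lit-p5 g11's `supp_coeff_rank`),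
and the pseudo-remainders of `…CuspCubicNonMonicAlgebra` are homogeneous of degree 9 in the letter data and
isobaric of weights 7/8/9, whence `supp R₂ ⊆ (9s + 7) • E`, `supp R₁ ⊆ (9s + 8) • E`, `supp R₀ ⊆ (9s + 9) • E`
(scripts generated by the seat's exact engine, checked here by the kernel); then, abstractly in `R₂, R₁, R₀`:
`supp L₁ ⊆ (19s + 16) • E`, `supp L₀ ⊆ (19s + 17) • E`, `supp N ⊆ (47s + 41) • E`, `supp N′ ⊆ (28s + 27) • E`, and the
numeric form of `OsculationCuspCubic.nonmonic_cubic_curve_ncard_le`'s bound, `≤ 20 · K ^ (47 s + 41)` for `s ≥ 1`.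

Honest framing: helper bookkeeping for a located column of an UNREGISTERED V1 law line; `OsculationLaw`, `PeelInequality`,
`MatrixDescartes`, Conjecture B and `VP ≠ VNP` are OPEN / NOT proved.  No definitions, no named facts.
-/

-- `Summit.ValiantsHypothesis.ValiantsHypothesis.…` is the tree's mandated single-conjunct layout (Sub = Summit).
set_option linter.dupNamespace false

noncomputable section

namespace Summit.ValiantsHypothesis.ValiantsHypothesis.Theorems.LacunarySymmetroidMatrixDescartes

open Polynomial
open scoped BigOperators Pointwise
open OsculationCusp

namespace OsculationCuspCubic
/-- `supp L₁ ⊆ (19s + 16) • E` for `L₁ = a₁R₂² − a₃R₀R₂ − a₂R₁R₂ + a₃R₁²`. [folklore] -/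
theorem supp_L1n {a₃ a₂ a₁ R₂ R₁ R₀ : ℝ[X]} {E : Finset ℕ} {s : ℕ} (h3 : a₃.support ⊆ s • E)
    (h2 : a₂.support ⊆ (s + 1) • E) (h1 : a₁.support ⊆ (s + 2) • E)
    (hR2 : R₂.support ⊆ (9 * s + 7) • E) (hR1 : R₁.support ⊆ (9 * s + 8) • E) (hR0 : R₀.support ⊆ (9 * s + 9) • E) :
    (a₁ * R₂ ^ 2 - a₃ * R₀ * R₂ - a₂ * R₁ * R₂ + a₃ * R₁ ^ 2).support ⊆ (19 * s + 16) • E :=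
  supp_add (supp_sub (supp_sub (supp_cast (supp_mul h1 (supp_pow hR2 2 (by norm_num))) (by ring))
    (supp_cast (supp_mul (supp_mul h3 hR0) hR2) (by ring))) (supp_cast (supp_mul (supp_mul h2 hR1) hR2) (by ring)))
    (supp_cast (supp_mul h3 (supp_pow hR1 2 (by norm_num))) (by ring))

/-- `supp L₀ ⊆ (19s + 17) • E` for `L₀ = a₀R₂² − a₂R₀R₂ + a₃R₀R₁`. [folklore] -/
theorem supp_L0n {a₃ a₂ a₀ R₂ R₁ R₀ : ℝ[X]} {E : Finset ℕ} {s : ℕ} (h3 : a₃.support ⊆ s • E)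
    (h2 : a₂.support ⊆ (s + 1) • E) (h0 : a₀.support ⊆ (s + 3) • E)
    (hR2 : R₂.support ⊆ (9 * s + 7) • E) (hR1 : R₁.support ⊆ (9 * s + 8) • E) (hR0 : R₀.support ⊆ (9 * s + 9) • E) :
    (a₀ * R₂ ^ 2 - a₂ * R₀ * R₂ + a₃ * R₀ * R₁).support ⊆ (19 * s + 17) • E :=
  supp_add (supp_sub (supp_cast (supp_mul h0 (supp_pow hR2 2 (by norm_num))) (by ring))
    (supp_cast (supp_mul (supp_mul h2 hR0) hR2) (by ring))) (supp_cast (supp_mul (supp_mul h3 hR0) hR1) (by ring))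

/-- `supp N ⊆ (47s + 41) • E` for `N = R₂L₀² − R₁L₀L₁ + R₀L₁²`. [folklore] -/
theorem supp_Nn {R₂ R₁ R₀ L₁ L₀ : ℝ[X]} {E : Finset ℕ} {s : ℕ}
    (hR2 : R₂.support ⊆ (9 * s + 7) • E) (hR1 : R₁.support ⊆ (9 * s + 8) • E) (hR0 : R₀.support ⊆ (9 * s + 9) • E)
    (hL1 : L₁.support ⊆ (19 * s + 16) • E) (hL0 : L₀.support ⊆ (19 * s + 17) • E) :
    (R₂ * L₀ ^ 2 - R₁ * L₀ * L₁ + R₀ * L₁ ^ 2).support ⊆ (47 * s + 41) • E :=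
  supp_add (supp_sub (supp_cast (supp_mul hR2 (supp_pow hL0 2 (by norm_num))) (by ring))
    (supp_cast (supp_mul (supp_mul hR1 hL0) hL1) (by ring))) (supp_cast (supp_mul hR0 (supp_pow hL1 2 (by norm_num))) (by ring))

/-- `supp N′ ⊆ (28s + 27) • E` for `N′ = a₀R₁³ − a₁R₀R₁² + a₂R₀²R₁ − a₃R₀³`. [folklore] -/
theorem supp_N'n {a₃ a₂ a₁ a₀ R₁ R₀ : ℝ[X]} {E : Finset ℕ} {s : ℕ} (h3 : a₃.support ⊆ s • E)
    (h2 : a₂.support ⊆ (s + 1) • E) (h1 : a₁.support ⊆ (s + 2) • E) (h0 : a₀.support ⊆ (s + 3) • E)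
    (hR1 : R₁.support ⊆ (9 * s + 8) • E) (hR0 : R₀.support ⊆ (9 * s + 9) • E) :
    (a₀ * R₁ ^ 3 - a₁ * R₀ * R₁ ^ 2 + a₂ * R₀ ^ 2 * R₁ - a₃ * R₀ ^ 3).support ⊆ (28 * s + 27) • E :=
  supp_sub (supp_add (supp_sub (supp_cast (supp_mul h0 (supp_pow hR1 3 (by norm_num))) (by ring))
    (supp_cast (supp_mul (supp_mul h1 hR0) (supp_pow hR1 2 (by norm_num))) (by ring)))
    (supp_cast (supp_mul (supp_mul h2 (supp_pow hR0 2 (by norm_num))) hR1) (by ring)))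
    (supp_cast (supp_mul h3 (supp_pow hR0 3 (by norm_num))) (by ring))

/-- Power bookkeeping with variable exponents: `K^i ≤ K^j` for `1 ≤ i ≤ j`. [folklore] -/
theorem pow_le_pow_of_le' (K i j : ℕ) (h1 : 1 ≤ i) (hij : i ≤ j) : K ^ i ≤ K ^ j := by
  rcases Nat.eq_zero_or_pos K with hK | hK
  · subst hK; rw [zero_pow (by omega), zero_pow (by omega)]
  · exact Nat.pow_le_pow_right hK hij

/-- **The numeric form of the non-monic count bound** at the splitting `(3, s)`, `s ≥ 1`, `|E| ≤ K`:
`|supp N| + |supp N′| + 3(|supp a₃| + |supp R₂| + |supp R₁| + |supp R₀| + |supp L₁| + |supp L₀|) ≤ 20·K^(47s+41)`.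
[folklore] -/
theorem bound_le_pow_gen {a₃ a₂ a₁ a₀ R₂ R₁ R₀ : ℝ[X]} {E : Finset ℕ} {K s : ℕ} (hs : 1 ≤ s) (hEK : E.card ≤ K)
    (h3 : a₃.support ⊆ s • E) (h2 : a₂.support ⊆ (s + 1) • E) (h1 : a₁.support ⊆ (s + 2) • E)
    (h0 : a₀.support ⊆ (s + 3) • E)
    (hR2 : R₂.support ⊆ (9 * s + 7) • E) (hR1 : R₁.support ⊆ (9 * s + 8) • E) (hR0 : R₀.support ⊆ (9 * s + 9) • E) :
    (R₂ * (a₀ * R₂ ^ 2 - a₂ * R₀ * R₂ + a₃ * R₀ * R₁) ^ 2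
          - R₁ * (a₀ * R₂ ^ 2 - a₂ * R₀ * R₂ + a₃ * R₀ * R₁) * (a₁ * R₂ ^ 2 - a₃ * R₀ * R₂ - a₂ * R₁ * R₂ + a₃ * R₁ ^ 2)
          + R₀ * (a₁ * R₂ ^ 2 - a₃ * R₀ * R₂ - a₂ * R₁ * R₂ + a₃ * R₁ ^ 2) ^ 2).support.card
      + (a₀ * R₁ ^ 3 - a₁ * R₀ * R₁ ^ 2 + a₂ * R₀ ^ 2 * R₁ - a₃ * R₀ ^ 3).support.card
      + 3 * (a₃.support.card + R₂.support.card + R₁.support.card + R₀.support.card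
          + (a₁ * R₂ ^ 2 - a₃ * R₀ * R₂ - a₂ * R₁ * R₂ + a₃ * R₁ ^ 2).support.card
          + (a₀ * R₂ ^ 2 - a₂ * R₀ * R₂ + a₃ * R₀ * R₁).support.card) ≤ 20 * K ^ (47 * s + 41) := by
  have hL1 := supp_L1n h3 h2 h1 hR2 hR1 hR0
  have hL0 := supp_L0n h3 h2 h0 hR2 hR1 hR0
  have cN := (card_support_le_of_subset_nsmul (supp_Nn hR2 hR1 hR0 hL1 hL0)).trans
    (Nat.pow_le_pow_left hEK (47 * s + 41))
  have cN' := (card_support_le_of_subset_nsmul (supp_N'n h3 h2 h1 h0 hR1 hR0)).trans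
    (Nat.pow_le_pow_left hEK (28 * s + 27))
  have c3 := (card_support_le_of_subset_nsmul h3).trans (Nat.pow_le_pow_left hEK s)
  have cR2 := (card_support_le_of_subset_nsmul hR2).trans (Nat.pow_le_pow_left hEK (9 * s + 7))
  have cR1 := (card_support_le_of_subset_nsmul hR1).trans (Nat.pow_le_pow_left hEK (9 * s + 8))
  have cR0 := (card_support_le_of_subset_nsmul hR0).trans (Nat.pow_le_pow_left hEK (9 * s + 9))
  have cL1 := (card_support_le_of_subset_nsmul hL1).trans (Nat.pow_le_pow_left hEK (19 * s + 16))
  have cL0 := (card_support_le_of_subset_nsmul hL0).trans (Nat.pow_le_pow_left hEK (19 * s + 17))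
  have e1 := pow_le_pow_of_le' K (28 * s + 27) (47 * s + 41) (by omega) (by omega)
  have e2 := pow_le_pow_of_le' K s (47 * s + 41) hs (by omega)
  have e3 := pow_le_pow_of_le' K (9 * s + 7) (47 * s + 41) (by omega) (by omega)
  have e4 := pow_le_pow_of_le' K (9 * s + 8) (47 * s + 41) (by omega) (by omega)
  have e5 := pow_le_pow_of_le' K (9 * s + 9) (47 * s + 41) (by omega) (by omega)
  have e6 := pow_le_pow_of_le' K (19 * s + 16) (47 * s + 41) (by omega) (by omega)
  have e7 := pow_le_pow_of_le' K (19 * s + 17) (47 * s + 41) (by omega) (by omega)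
  omega

end OsculationCuspCubic

end Summit.ValiantsHypothesis.ValiantsHypothesis.Theorems.LacunarySymmetroidMatrixDescartes
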